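import Literature.NumberTheory.EllipticCurves.BigRepModuleDualShiftedEndomorphismCharIdealProofs
import Literature.NumberTheory.EllipticCurves.BigRepModuleFiniteCoeffDualProofs
import Literature.NumberTheory.EllipticCurves.BigRepModuleShiftedFixedPointsProofs
import Literature.NumberTheory.EllipticCurves.CharIdealDualInflationStepProofs
import HarnessLib

/-!
# The dual of `ker(τ_c ∘ F_* − 1)` on `B ⊗ Λ^*` for a COFINITELY GENERATED `B`
# (`0 → D → B → Q`, `D` cofree, `Q` finite, `c ≠ 0`): finitely generated, torsion, and
# `Ch_Λ = (det((1+T)^c·ᵗM_D − 1))` — [GreenbergVatsal2000] Prop. 2.4 with the finite part, PROVED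

Topic `Literature/NumberTheory/EllipticCurves` (namespace = path + `BigRepModule`). THEOREMS ONLY: no
definition, no named fact, no instance, no `sorry`. Cell `bsd-stepL` (typer lane `defn-ty1`, g10):
module L5 step (S3) of the discharge of the local atom
`JetchevSkinnerWan2017.sigmaLocal_charIdeal_eulerFactor_mem_of_noTamagawaDefect` (K2 support 20495) at a
FINITELY DECOMPOSED place of good or multiplicative reduction, where the coefficient module
`B = H¹(I_w, E[p^∞])` is cofinitely generated but not cofree: its maximal divisible submodule `D` is
cofree and `Q = B/D` is finite.

## The printed statement

[GreenbergVatsal2000] Prop. (2.4) (arXiv:math/9906215 p. 22): "The characteristic ideal of the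
`Λ`-module `ℋ_ℓ(ℚ_∞)^` is generated by `𝓟_ℓ = P_ℓ(ℓ⁻¹γ_ℓ)`, `P_ℓ(X) = det((1 − Frob_ℓ X)|_{(V_p)_{I_ℓ}})`"
— proof p. 22: "`H¹(Ī_ℓ, A_{J_ℓ}) ≅ A_{I_ℓ}(−1)` … The eigenvalues of `Frob_ℓ` acting on `A_{I_ℓ}(−1)^` …
those numbers which are principal units are the eigenvalues of `γ_ℓ` acting on
`(A_{I_ℓ}(−1)^{G/Ī_ℓ})^`, again using the fact that `G/Ī_ℓ` has profinite order prime to `p`." Only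
the DIVISIBLE part of `A_{I_ℓ}(−1)` contributes to the characteristic ideal; the finite part
contributes a finite (pseudo-null) module.

## What is proved (over `Λ = ℤ_p⟦T⟧`; `L(X) = BigRepModule ℤ_[p] p X`, `X^∨ =` Mathlib `CharacterModule`)

For `p`-primary `ℤ_p`-modules `0 → D —ι→ B —π→ Q` exact at `B` with `ι` injective, `D` COFREE (a
Pontryagin dual datum `(Y, tD)` free with basis `b : Fin n`), `Q` FINITE, endomorphisms `F_D, F_B, F_Q`
compatible with `ι, π`, an adjoint `Lt` of `F_D` on `Y`, `c ∈ ℤ_p ∖ {0}`, and ANY `Λ`-linear `E_B` on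
`L(B)` with `E_B Φ = τ_c (F_{B*} Φ) − Φ`:
* `exists_shiftedEndo` — the shifted endomorphism `τ_c ∘ F_* − 1` IS `Λ`-linear
  (`τ_c = (1+T)^c •`, tree `translate_eq_binomSeries_smul`), so `E_D`, `E_Q` need not be supplied;
* `mapRange_shiftedEndo` — `ι_* ∘ E_D = E_B ∘ ι_*` (naturality), `mapRange_mem_ker_shiftedEndo`;
* `finite_ker_shiftedEndo` — `ker E_Q` is FINITE for finite `Q` and `c ≠ 0` (tree
  `finite_setOf_fixed_shift`, imc-p1 g13);
* `exact_kerRestrict_shiftedEndo` — `0 → ker E_D → ker E_B → ker E_Q` is exact (exactness of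
  `X ↦ L(X)`, tree `exact_mapRangeₗ_of_injective`);
* **`finite_isTorsion_charIdeal_characterModule_ker_shiftedEndo_of_exact`** — `(ker E_B)^∨` is a
  finitely generated torsion `Λ`-module with **`Ch_Λ((ker E_B)^∨) = (det N)`**,
  `N = (1+T)^c · ᵗM − 1`, `ᵗM = (toMatrix b b Lt).map C` (the cofree case
  `finite_isTorsion_charIdeal_characterModule_ker_shiftedEndo` for `D`, then
  `0 → (ker E_B / ker E_D)^∨ → (ker E_B)^∨ → (ker E_D)^∨ → 0` with the left term finite, hence
  pseudo-null with `Ch = ⊤`, and multiplicativity of `Ch`), provided `det N ≠ 0`;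
  `det_mem_charIdeal_characterModule_ker_shiftedEndo_of_exact` — membership form.

HONEST FRAMING: pure `Λ`-module algebra; the named local fact is NOT discharged here (the arithmetic
inputs — `H¹(I_w, E[p^∞])`, its divisible part, Frobenius and `det N` vs `eulerFactor` — remain,
`HOME/imc-p1/g13/L5-PLAN` (S3)/(S5)).

References: [GreenbergVatsal2000] Prop. 2.4 and proof (arXiv pp. 21–22); [Serre1979] Chap. I §5
Lemma 3; [Washington1997] §13.2 (finite `Λ`-modules are pseudo-null); [Tate1966Bourbaki] §5 Lemma z.3;
[CoatesSujatha2006Cyclotomic] §3.3 Lemma 3.3.4.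
-/

noncomputable section

open Literature.NumberTheory.IwasawaTheory.Greenberg2016
open Literature.NumberTheory.EllipticCurves.Module

namespace Literature.NumberTheory.EllipticCurves.BigRepModule

/-! ## §1 The shifted endomorphism is `Λ`-linear; naturality; kernels -/

section Generic

universe u

variable {𝒪 : Type u} [CommRing 𝒪] {p : ℕ} [Fact p.Prime] [Algebra ℤ_[p] 𝒪]
  {A A' : Type u} [AddCommGroup A] [Module 𝒪 A] [AddCommGroup A'] [Module 𝒪 A']

/-- **`τ_c ∘ F_* − 1` is `𝒪⟦T⟧`-linear**: it is `Φ ↦ (1+T)^c • F_* Φ − Φ`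
(`translate_eq_binomSeries_smul`), so there is an `𝒪⟦T⟧`-linear `E` with `E Φ = τ_c (F_* Φ) − Φ`.
[cite: CoatesSujatha2006Cyclotomic, Lemma 3.3.4 (§3.3 p. 37: 1_{ℤ_p} ↦ 1 + T)] -/
theorem exists_shiftedEndo (F : A →ₗ[𝒪] A) (c : ℤ_[p]) :
    ∃ E : BigRepModule 𝒪 p A →ₗ[PowerSeries 𝒪] BigRepModule 𝒪 p A,
      ∀ Φ, E Φ = translate c (mapRange F Φ) - Φ :=
  ⟨LinearMap.lsmul (PowerSeries 𝒪) (BigRepModule 𝒪 p A) (binomSeries 𝒪 c) ∘ₗ mapRangeₗ F -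
      LinearMap.id,
    fun Φ ↦ by
      rw [LinearMap.sub_apply, LinearMap.comp_apply, LinearMap.lsmul_apply, mapRangeₗ_apply,
        LinearMap.id_apply, translate_eq_binomSeries_smul]⟩

omit [Algebra ℤ_[p] 𝒪] in
/-- **Naturality of the shifted endomorphism**: for `L : A → A'` intertwining `F` and `F'`
(`L ∘ F = F' ∘ L`), `L_* (E Φ) = E' (L_* Φ)`.
[cite: GreenbergVatsal2000, proof of Prop. 2.4 (arXiv p. 22)] -/
theorem mapRange_shiftedEndo (L : A →ₗ[𝒪] A') (F : A →ₗ[𝒪] A) (F' : A' →ₗ[𝒪] A')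
    (hLF : L ∘ₗ F = F' ∘ₗ L) (c : ℤ_[p])
    (E : BigRepModule 𝒪 p A →ₗ[PowerSeries 𝒪] BigRepModule 𝒪 p A)
    (hE : ∀ Φ, E Φ = translate c (mapRange F Φ) - Φ)
    (E' : BigRepModule 𝒪 p A' →ₗ[PowerSeries 𝒪] BigRepModule 𝒪 p A')
    (hE' : ∀ Φ, E' Φ = translate c (mapRange F' Φ) - Φ) (Φ : BigRepModule 𝒪 p A) :
    mapRange L (E Φ) = E' (mapRange L Φ) := by
  rw [hE, hE', map_sub, mapRange_translate, ← LinearMap.comp_apply (mapRange L) (mapRange F),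
    ← mapRange_comp, hLF, mapRange_comp, LinearMap.comp_apply]

omit [Algebra ℤ_[p] 𝒪] in
/-- `L_*` maps `ker E` into `ker E'` (naturality). [cite: GreenbergVatsal2000, proof of Prop. 2.4 (arXiv p. 22)] -/
theorem mapRange_mem_ker_shiftedEndo (L : A →ₗ[𝒪] A') (F : A →ₗ[𝒪] A) (F' : A' →ₗ[𝒪] A')
    (hLF : L ∘ₗ F = F' ∘ₗ L) (c : ℤ_[p])
    (E : BigRepModule 𝒪 p A →ₗ[PowerSeries 𝒪] BigRepModule 𝒪 p A)
    (hE : ∀ Φ, E Φ = translate c (mapRange F Φ) - Φ)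
    (E' : BigRepModule 𝒪 p A' →ₗ[PowerSeries 𝒪] BigRepModule 𝒪 p A')
    (hE' : ∀ Φ, E' Φ = translate c (mapRange F' Φ) - Φ) (Φ : BigRepModule 𝒪 p A)
    (hΦ : Φ ∈ LinearMap.ker E) : mapRangeₗ (p := p) L Φ ∈ LinearMap.ker E' := by
  rw [LinearMap.mem_ker] at hΦ ⊢
  rw [mapRangeₗ_apply, ← mapRange_shiftedEndo L F F' hLF c E hE E' hE', hΦ, map_zero]

omit [Algebra ℤ_[p] 𝒪] in
/-- **`ker(τ_c ∘ F_* − 1)` is FINITE for finite `A` and `c ≠ 0`** (its elements are the fixed points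
`Φ(x) = F(Φ(x + c))` of a shifted endomorphism; tree `finite_setOf_fixed_shift` with shift `−c`).
[cite: GreenbergVatsal2000, Prop. 2.4 (finitely decomposed primes)] -/
theorem finite_ker_shiftedEndo [Finite A] (F : A →ₗ[𝒪] A) {c : ℤ_[p]} (hc : c ≠ 0)
    (E : BigRepModule 𝒪 p A →ₗ[PowerSeries 𝒪] BigRepModule 𝒪 p A)
    (hE : ∀ Φ, E Φ = translate c (mapRange F Φ) - Φ) : Finite (LinearMap.ker E) := by
  have hfin : (LinearMap.ker E : Set (BigRepModule 𝒪 p A)).Finite := by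
    refine (finite_setOf_fixed_shift (p := p) F (neg_ne_zero.mpr hc)).subset ?_
    intro Φ hΦ x
    have h0 : E Φ = 0 := hΦ
    rw [hE, sub_eq_zero] at h0
    have hx := congrArg (fun Ψ : BigRepModule 𝒪 p A ↦ Ψ x) h0
    simpa only [translate_apply, mapRange_apply, sub_neg_eq_add] using hx
  exact hfin.to_subtype

end Generic

/-! ## §2 The kernel sequence `0 → ker E_D → ker E_B → ker E_Q` and the characteristic ideal -/

section Cofinite

variable {p : ℕ} [Fact p.Prime]
  {D B Q : Type} [AddCommGroup D] [Module ℤ_[p] D] [AddCommGroup B] [Module ℤ_[p] B]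
  [AddCommGroup Q] [Module ℤ_[p] Q]

/-- **Exactness of the kernel sequence** `0 → ker E_D → ker E_B → ker E_Q` induced by an exact
`0 → D —ι→ B —π→ Q` (`ι` injective) and compatible endomorphisms: the maps are the restrictions of
`ι_*`, `π_*` (tree: `X ↦ L(X) = X ⊗ Λ^*` is exact, `exact_mapRangeₗ_of_injective`), and the
restriction of `ι_*` is injective. [cite: GreenbergVatsal2000, proof of Prop. 2.4 (arXiv p. 22)]
[cite: PollackWeston2011, Lemma 3.2 (functoriality of · ⊗ Λ^∨ in the coefficients)] -/
theorem exact_kerRestrict_shiftedEndo (ι : D →ₗ[ℤ_[p]] B) (hι : Function.Injective ι)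
    (π : B →ₗ[ℤ_[p]] Q) (hιπ : Function.Exact ι π)
    (F_D : D →ₗ[ℤ_[p]] D) (F_B : B →ₗ[ℤ_[p]] B) (F_Q : Q →ₗ[ℤ_[p]] Q)
    (hFι : ι ∘ₗ F_D = F_B ∘ₗ ι) (hFπ : π ∘ₗ F_B = F_Q ∘ₗ π) (c : ℤ_[p])
    (E_D : BigRepModule ℤ_[p] p D →ₗ[PowerSeries ℤ_[p]] BigRepModule ℤ_[p] p D)
    (hE_D : ∀ Φ, E_D Φ = translate c (mapRange F_D Φ) - Φ)
    (E_B : BigRepModule ℤ_[p] p B →ₗ[PowerSeries ℤ_[p]] BigRepModule ℤ_[p] p B)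
    (hE_B : ∀ Φ, E_B Φ = translate c (mapRange F_B Φ) - Φ)
    (E_Q : BigRepModule ℤ_[p] p Q →ₗ[PowerSeries ℤ_[p]] BigRepModule ℤ_[p] p Q)
    (hE_Q : ∀ Φ, E_Q Φ = translate c (mapRange F_Q Φ) - Φ) :
    Function.Injective ((mapRangeₗ (p := p) ι).restrict
        (mapRange_mem_ker_shiftedEndo ι F_D F_B hFι c E_D hE_D E_B hE_B)) ∧
      Function.Exact
        ((mapRangeₗ (p := p) ι).restrict
          (mapRange_mem_ker_shiftedEndo ι F_D F_B hFι c E_D hE_D E_B hE_B))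
        ((mapRangeₗ (p := p) π).restrict
          (mapRange_mem_ker_shiftedEndo π F_B F_Q hFπ c E_B hE_B E_Q hE_Q)) := by
  have hex := exact_mapRangeₗ_of_injective (p := p) hι hιπ
  refine ⟨fun Φ Ψ h ↦ Subtype.ext (mapRange_injective (p := p) hι
    (by simpa only [LinearMap.restrict_apply, Subtype.mk.injEq, mapRangeₗ_apply] using
      congrArg Subtype.val h)), ?_⟩
  intro Φ
  constructor
  · intro hΦ
    have h0 : mapRangeₗ (p := p) π Φ.1 = 0 := by
      have h := congrArg Subtype.val hΦ
      rwa [LinearMap.coe_restrict_apply, ZeroMemClass.coe_zero] at h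
    obtain ⟨Ψ, hΨ⟩ := (hex Φ.1).mp h0
    have hΨker : Ψ ∈ LinearMap.ker E_D := by
      rw [LinearMap.mem_ker]
      apply mapRange_injective (p := p) hι
      rw [map_zero, mapRange_shiftedEndo ι F_D F_B hFι c E_D hE_D E_B hE_B, ← mapRangeₗ_apply, hΨ]
      exact Φ.2
    exact ⟨⟨Ψ, hΨker⟩, Subtype.ext (by rw [LinearMap.restrict_apply]; exact hΨ)⟩
  · rintro ⟨Ψ, rfl⟩
    apply Subtype.ext
    rw [LinearMap.restrict_apply, LinearMap.restrict_apply]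
    change mapRangeₗ (p := p) π (mapRangeₗ (p := p) ι Ψ.1) = 0
    exact (hex _).mpr ⟨Ψ.1, rfl⟩

/-- The character module of a finite abelian group is finite (characters take values in the
`#B`-torsion of `ℚ/ℤ`); a private copy of the tree's `SkinnerUrban2014.….finite_characterModule`.
[folklore] -/
private theorem finite_characterModule' (X : Type*) [AddCommGroup X] [Finite X] :
    Finite (CharacterModule X) :=
  Literature.NumberTheory.EllipticCurves.SkinnerUrban2014.finite_characterModule X

/-- **[GreenbergVatsal2000] Prop. 2.4 for a cofinitely generated coefficient module.** Let
`0 → D —ι→ B —π→ Q` be `p`-primary `ℤ_p`-modules, exact at `B` with `ι` injective, `D` COFREE of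
corank `n` (Pontryagin dual datum `(Y, tD)` free with basis `b`), `Q` FINITE; `F_D, F_B, F_Q`
endomorphisms compatible with `ι, π`; `Lt` an adjoint of `F_D` on `Y` (`tD (Lt y) d = tD y (F_D d)`);
`c ∈ ℤ_p`, `c ≠ 0`; `E_B` any `Λ`-linear endomorphism of `L(B) = B ⊗ Λ^*` with
`E_B Φ = τ_c (F_{B*} Φ) − Φ`. If `N = (1+T)^c · ᵗM − 1` (`ᵗM = (toMatrix b b Lt).map C`) has
`det N ≠ 0`, then `(ker E_B)^∨` is a finitely generated torsion `Λ`-module and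
**`Ch_Λ((ker E_B)^∨) = (det N)`**: `0 → (ker E_B / ker E_D)^∨ → (ker E_B)^∨ → (ker E_D)^∨ → 0` with the
left term finite (it is dual to a submodule of the finite `ker E_Q`), hence pseudo-null with
`Ch = ⊤`, the right term free-quotient with `Ch = (det N)`, and `Ch` multiplicative.
[cite: GreenbergVatsal2000, Prop. 2.4 and proof (arXiv pp. 21–22)]
[cite: Washington1997, §13.2 (finite Λ-modules are pseudo-null; Ch multiplicative)] -/
theorem finite_isTorsion_charIdeal_characterModule_ker_shiftedEndo_of_exact
    (hD : ∀ d : D, ∃ k : ℕ, p ^ k • d = 0) [Finite Q]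
    (ι : D →ₗ[ℤ_[p]] B) (hι : Function.Injective ι) (π : B →ₗ[ℤ_[p]] Q)
    (hιπ : Function.Exact ι π)
    {Y : Type} [AddCommGroup Y] [Module ℤ_[p] Y] {tD : Y →+ (D →+ AddCircle (1 : ℚ))}
    (hY : IsDualPairing ℤ_[p] D tD) {n : ℕ} (b : Module.Basis (Fin n) ℤ_[p] Y)
    (F_D : D →ₗ[ℤ_[p]] D) (F_B : B →ₗ[ℤ_[p]] B) (F_Q : Q →ₗ[ℤ_[p]] Q)
    (hFι : ι ∘ₗ F_D = F_B ∘ₗ ι) (hFπ : π ∘ₗ F_B = F_Q ∘ₗ π)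
    (Lt : Y →ₗ[ℤ_[p]] Y) (hLt : ∀ (y : Y) (d : D), tD (Lt y) d = tD y (F_D d))
    {c : ℤ_[p]} (hc : c ≠ 0)
    (E_B : BigRepModule ℤ_[p] p B →ₗ[PowerSeries ℤ_[p]] BigRepModule ℤ_[p] p B)
    (hE_B : ∀ Φ, E_B Φ = translate c (mapRange F_B Φ) - Φ)
    (hN : (binomSeries ℤ_[p] c • (LinearMap.toMatrix b b Lt).map (PowerSeries.C (R := ℤ_[p])) - 1).det
      ≠ 0) :
    Module.Finite (PowerSeries ℤ_[p]) (CharacterModule (LinearMap.ker E_B)) ∧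
      Module.IsTorsion (PowerSeries ℤ_[p]) (CharacterModule (LinearMap.ker E_B)) ∧
        Module.charIdeal (PowerSeries ℤ_[p]) (CharacterModule (LinearMap.ker E_B)) =
          Ideal.span {(binomSeries ℤ_[p] c • (LinearMap.toMatrix b b Lt).map
            (PowerSeries.C (R := ℤ_[p])) - 1).det} := by
  classical
  set P := (binomSeries ℤ_[p] c • (LinearMap.toMatrix b b Lt).map
    (PowerSeries.C (R := ℤ_[p])) - 1).det with hPdef
  -- the shifted endomorphisms on `L(D)` and `L(Q)`
  obtain ⟨E_D, hE_D⟩ := exists_shiftedEndo (𝒪 := ℤ_[p]) (p := p) F_D c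
  obtain ⟨E_Q, hE_Q⟩ := exists_shiftedEndo (𝒪 := ℤ_[p]) (p := p) F_Q c
  -- the kernel sequence
  set i : LinearMap.ker E_D →ₗ[PowerSeries ℤ_[p]] LinearMap.ker E_B :=
    (mapRangeₗ (p := p) ι).restrict
      (mapRange_mem_ker_shiftedEndo ι F_D F_B hFι c E_D hE_D E_B hE_B) with hidef
  set r : LinearMap.ker E_B →ₗ[PowerSeries ℤ_[p]] LinearMap.ker E_Q :=
    (mapRangeₗ (p := p) π).restrict
      (mapRange_mem_ker_shiftedEndo π F_B F_Q hFπ c E_B hE_B E_Q hE_Q) with hrdef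
  obtain ⟨hi, hir⟩ := exact_kerRestrict_shiftedEndo ι hι π hιπ F_D F_B F_Q hFι hFπ c E_D hE_D E_B hE_B
    E_Q hE_Q
  -- the cofree part: `(ker E_D)^∨` f.g., torsion, `Ch = (P)`
  obtain ⟨hDfg, hDtors, hDch⟩ :=
    finite_isTorsion_charIdeal_characterModule_ker_shiftedEndo hD hY b F_D Lt hLt c E_D hE_D hN
  haveI := hDfg
  -- the finite part: `ker E_Q` finite, so its dual is finite, f.g., torsion, `Ch = ⊤`
  haveI : Finite (LinearMap.ker E_Q) := finite_ker_shiftedEndo F_Q hc E_Q hE_Q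
  haveI : Finite (CharacterModule (LinearMap.ker E_Q)) := finite_characterModule' _
  have hQtors : Module.IsTorsion (PowerSeries ℤ_[p]) (CharacterModule (LinearMap.ker E_Q)) :=
    isTorsion_of_finite_iwasawa (p := p) (CharacterModule (LinearMap.ker E_Q))
  -- the quotient `ker E_B / i(ker E_D)` embeds into `ker E_Q`, so its dual is finite
  set U : Submodule (PowerSeries ℤ_[p]) (LinearMap.ker E_B) := LinearMap.range i with hU
  have hle : U ≤ LinearMap.ker r := by rw [hU, ← hir.linearMap_ker_eq]
  set rbar : (LinearMap.ker E_B ⧸ U) →ₗ[PowerSeries ℤ_[p]] LinearMap.ker E_Q := U.liftQ r hle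
    with hrbar_def
  have hrbar : Function.Injective rbar := by
    rw [← LinearMap.ker_eq_bot]
    exact Submodule.ker_liftQ_eq_bot _ _ _ (by rw [hU, ← hir.linearMap_ker_eq])
  haveI : Finite (LinearMap.ker E_B ⧸ U) := Finite.of_injective rbar hrbar
  haveI : Finite (CharacterModule (LinearMap.ker E_B ⧸ U)) := finite_characterModule' _
  -- `0 → (ker E_B / U)^∨ → (ker E_B)^∨ → (ker E_D)^∨ → 0`
  have hf₁ : Function.Injective (CharacterModule.dual (R := PowerSeries ℤ_[p]) U.mkQ) :=
    CharacterModule.dual_injective_of_surjective _ (Submodule.mkQ_surjective U)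
  have hg₁ : Function.Surjective (CharacterModule.dual i) :=
    CharacterModule.dual_surjective_of_injective i hi
  have hex₁ : Function.Exact (CharacterModule.dual (R := PowerSeries ℤ_[p]) U.mkQ)
      (CharacterModule.dual i) :=
    TateBourbaki.exact_dual_mkQ_dual i
  -- `(ker E_B)^∨` is finitely generated: extension of f.g. by f.g.
  have hfgB : Module.Finite (PowerSeries ℤ_[p]) (CharacterModule (LinearMap.ker E_B)) := by
    rw [Module.finite_def]
    refine Submodule.fg_of_fg_map_of_fg_inf_ker (CharacterModule.dual i) ?_ ?_
    · rw [Submodule.map_top, LinearMap.range_eq_top.mpr hg₁]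
      exact Module.finite_def.mp inferInstance
    · rw [top_inf_eq, hex₁.linearMap_ker_eq, LinearMap.range_eq_map]
      exact (Module.finite_def.mp inferInstance).map _
  haveI := hfgB
  -- torsion (one localisation step with `L = ker E_Q`)
  obtain ⟨hBtors, -⟩ := isTorsion_and_charIdeal_mul_span_le_of_exact_dual i hi r hir hDtors hQtors
    (P := (1 : PowerSeries ℤ_[p])) (by
      rw [charIdeal_eq_top_of_isPseudoNull
        (Literature.NumberTheory.EllipticCurves.isPseudoNull_of_finite p
          (CharacterModule (LinearMap.ker E_Q)))]
      exact Submodule.mem_top)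
  -- multiplicativity on `0 → (ker E_B / U)^∨ → (ker E_B)^∨ → (ker E_D)^∨ → 0`
  have hmul := charIdeal_eq_mul_of_exact hBtors _ _ hf₁ hg₁ hex₁
  have htop : Module.charIdeal (PowerSeries ℤ_[p]) (CharacterModule (LinearMap.ker E_B ⧸ U)) = ⊤ :=
    charIdeal_eq_top_of_isPseudoNull
      (Literature.NumberTheory.EllipticCurves.isPseudoNull_of_finite p
        (CharacterModule (LinearMap.ker E_B ⧸ U)))
  rw [htop, Ideal.top_mul, hDch] at hmul
  exact ⟨hfgB, hBtors, hmul⟩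

/-- Membership form: `det((1+T)^c · ᵗM − 1) ∈ Ch_Λ((ker E_B)^∨)`.
[cite: GreenbergVatsal2000, Prop. 2.4 and proof (arXiv pp. 21–22)] -/
theorem det_mem_charIdeal_characterModule_ker_shiftedEndo_of_exact
    (hD : ∀ d : D, ∃ k : ℕ, p ^ k • d = 0) [Finite Q]
    (ι : D →ₗ[ℤ_[p]] B) (hι : Function.Injective ι) (π : B →ₗ[ℤ_[p]] Q)
    (hιπ : Function.Exact ι π)
    {Y : Type} [AddCommGroup Y] [Module ℤ_[p] Y] {tD : Y →+ (D →+ AddCircle (1 : ℚ))}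
    (hY : IsDualPairing ℤ_[p] D tD) {n : ℕ} (b : Module.Basis (Fin n) ℤ_[p] Y)
    (F_D : D →ₗ[ℤ_[p]] D) (F_B : B →ₗ[ℤ_[p]] B) (F_Q : Q →ₗ[ℤ_[p]] Q)
    (hFι : ι ∘ₗ F_D = F_B ∘ₗ ι) (hFπ : π ∘ₗ F_B = F_Q ∘ₗ π)
    (Lt : Y →ₗ[ℤ_[p]] Y) (hLt : ∀ (y : Y) (d : D), tD (Lt y) d = tD y (F_D d))
    {c : ℤ_[p]} (hc : c ≠ 0)
    (E_B : BigRepModule ℤ_[p] p B →ₗ[PowerSeries ℤ_[p]] BigRepModule ℤ_[p] p B)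
    (hE_B : ∀ Φ, E_B Φ = translate c (mapRange F_B Φ) - Φ)
    (hN : (binomSeries ℤ_[p] c • (LinearMap.toMatrix b b Lt).map (PowerSeries.C (R := ℤ_[p])) - 1).det
      ≠ 0) :
    (binomSeries ℤ_[p] c • (LinearMap.toMatrix b b Lt).map (PowerSeries.C (R := ℤ_[p])) - 1).det ∈
      Module.charIdeal (PowerSeries ℤ_[p]) (CharacterModule (LinearMap.ker E_B)) := by
  rw [(finite_isTorsion_charIdeal_characterModule_ker_shiftedEndo_of_exact hD ι hι π hιπ hY b F_D F_B
    F_Q hFι hFπ Lt hLt hc E_B hE_B hN).2.2]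
  exact Ideal.mem_span_singleton_self _

end Cofinite

end Literature.NumberTheory.EllipticCurves.BigRepModule
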